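import Literature.NumberTheory.Automorphic.SLTwoTreeQuadraticTorusShellIndexCount   -- ★ (W′1) V-INDEX (A-p01 (g21)): Eisenstein twin, `mem_maximalIdeal_pow_iff_valuation_le_pow`, regRep ∕ centraliser API
import Literature.NumberTheory.Automorphic.SLTwoTreeQuadraticTorusShellOrbit        -- ★ (W′1) V-a (A-p17 (g23)): `mem_centralizer_companion_iff`, `mem_centralizer_inf_glInt_iff`
import HarnessLib

/-!
# The non-split quadratic torus on the tree of `SL₂(F)`, V-INDEX-unr: the conductor-`m` unit index `[𝒪_E^× : (𝒪 + ϖ^m 𝒪 τ)^×] = (q+1)·q^{m−1}` in the INERT shape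
# (Labesse–Langlands 1979 §2 p. 8, `δ_m = (q+1)q^{m−1}` «if `L` is unramified»)

Topic `NumberTheory/Automorphic`; namespace `Literature.NumberTheory.Automorphic.HermitianLatticeTree` (ROAD W's).  KERNEL mathematics only: theorems, no definition, no
named fact, no instance, no notation, no `sorry`.  Cell `pub/hodgecm-mathlib` (D-0151), crux H413 = `stmt-HodgeConjecture-24833`; «S3-ram» seeding wave (LEAD F0P3a-plan (g12)
T11-41∕T11-62; owner F0P3a-p06 (g15)); seat A-p12 (g23), organ «(W′1)-V-unr» = the UNRAMIFIED twin that ★ `SLTwoTreeQuadraticTorusShellCount` (A-p17 (g23)) and ★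
`SLTwoTreeQuadraticTorusShellIndexCount` (A-p01 (g21)) name as «NOT here».  Consumer: the type-(2) H-side profiles at a tame-RAMIFIED CM place (P-2-ram skeleton (α₂),
STUB B₂): a type-(2) element of EVEN discriminant depth has UNRAMIFIED eigen-ratio field, its torus fixes VERTEX-centred balls, shells `δ_0 = 1`, `δ_m = (q+1)q^{m−1}`.
HONEST LABEL: HC_CM is proved only modulo the cell's 2 remaining named inputs (hLiu418 24832, h413 24833) until rung 0 closes; nothing printed is asserted here — elementary
`2 × 2` algebra over a discrete valuation ring with finite residue field.

THE MATHEMATICS (tokens of (W′1) I–V: torus `T = {(c, ev; e, c + eu)} ⊂ GL₂(F)` = the regular representation of `F[τ]^×`, `τ² = uτ + v`, companion matrix `γτ = (0, v; 1, u)`,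
`r_m = diag(1, ϖ^m)`, `TK := Subgroup.centralizer {γτ} ⊓ GL₂(𝒪)` (`= 𝒪_E^×`), `TK(m) := TK ⊓ r_m GL₂(𝒪) r_m⁻¹` (`= (𝒪 + ϖ^m𝒪τ)^×`)).  INERT SHAPE: `u v ∈ 𝒪` and the norm
form is ANISOTROPIC modulo `𝔭` — `hanis : ∀ c e ∈ 𝒪, |c² + ceu − e²v| < 1 → |c| < 1 ∧ |e| < 1` (`X² − ūX − v̄` irreducible over `𝓀`; `E = F(τ)` UNRAMIFIED, `𝒪_E = 𝒪 ⊕ 𝒪τ`).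
* §1 Inert units: `valuation_eq_one_of_valuation_lt_one_of_inertNorm` (`|e| < 1`, `|N| = 1 ⇒ |c| = 1`; shape-free), `valuation_inertNorm_eq_one_of_or` (`c` OR `e` a unit ⇒
  `c + eτ` a unit), `integral_of_valuation_inertNorm_le_one` (the non-split∕integral-basis binder `hE` of (W′1) FOLLOWS from `hanis`), `valuation_inertNorm_ne_valuation` (NO
  element of the order has `|N| = |ϖ|`: `E ∕ F` is UNRAMIFIED).
* §2 THE COSET CRITERION, shape-free (no division by `c`): for `t, t′ ∈ TK` with coordinates `(c, e)`, `(c′, e′)`, **`t⁻¹t′ ∈ r_m GL₂(𝒪) r_m⁻¹ ⟺ |ce′ − ec′| ≤ |ϖ|^m`**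
  (`ce′ − ec′ = e″·N(t)` for the τ-coordinate `e″` of `t⁻¹t′`; ★ I `isIntegralMatrix_shellConj_iff`); and `TK(0).relIndex TK = 1` (`r_0 = 1`).
* §3 THE INDEX **`TK(m).relIndex TK = (q + 1)·q^{m−1}`** for `m ≥ 1` (`q = #𝓀_F`): `t = (c, e) ↦ inl (c·e⁻¹ mod 𝔪^m)` if `|e| = 1`, `↦ inr (e·c⁻¹·ϖ⁻¹ mod 𝔪^{m−1})` if
  `|e| < 1` is a BIJECTION `TK ∕ TK(m) → (𝒪∕𝔪^m) ⊕ (𝒪∕𝔪^{m−1})` (= `ℙ¹(𝒪∕𝔪^m)`) by §2, onto by the units `(z, 1)`, `(1, ϖz)`; `#(𝒪∕𝔪^k) = q^k` (`cardQuot_pow_of_prime`).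
(V-ORBIT-unr) — ONE `TK`-orbit per shell, the fixed shells of a unit `a + bτ`, the vertex-ball count `(q−1)·#Fix + 2 = (q+1)qⁿ` — is the sequel `SLTwoTreeQuadraticTorusShellCountUnramified`.

## References
* [LabesseLanglands1979] J.-P. Labesse, R. P. Langlands, *L-indistinguishability for SL(2)*, Canad. J. Math. 31 (1979), §2 p. 8 (`δ_m = (q+1)q^{m−1}` if `L` is unramified).
* [Serre1980Trees] J.-P. Serre, *Trees* (1980), Ch. II §1.1 (balls and spheres in the tree of `SL₂`: `|S(x, m)| = (q+1)q^{m−1}`), §1.3.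
* [Neukirch1999] J. Neukirch, *Algebraic Number Theory* (1999), Ch. I §12 (unit index of an order of conductor `m`).
-/

set_option autoImplicit false

noncomputable section

open scoped ValuativeRel Matrix MatrixGroups
open Matrix ValuativeRel

namespace Literature.NumberTheory.Automorphic.HermitianLatticeTree

open Literature.NumberTheory.Automorphic Literature.NumberTheory.LocalFields

variable {F : Type*} [Field F] [ValuativeRel F] {ϖ : F} (hϖ : IsUniformizingElement ϖ)

/-! ## §1 Inert units -/

/-- **`|e| < 1` and `|c² + ceu − e²v| = 1` force `|c| = 1`** (`c, e, u, v ∈ 𝒪`; shape-free: if also `|c| < 1` every term of the norm has valuation `< 1`).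
[cite: LabesseLanglands1979, §2 p. 8] -/
theorem valuation_eq_one_of_valuation_lt_one_of_inertNorm {u v c e : F} (hu : u ∈ 𝒪[F]) (hv : v ∈ 𝒪[F]) (hc : c ∈ 𝒪[F])
    (hev : valuation F e < 1) (hN : valuation F (c ^ 2 + c * e * u - e ^ 2 * v) = 1) : valuation F c = 1 := by
  have hc1 : valuation F c ≤ 1 := (Valuation.mem_integer_iff _ _).1 hc
  have hu1 : valuation F u ≤ 1 := (Valuation.mem_integer_iff _ _).1 hu
  have hv1 : valuation F v ≤ 1 := (Valuation.mem_integer_iff _ _).1 hv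
  by_contra hne
  have hclt : valuation F c < 1 := lt_of_le_of_ne hc1 hne
  have h1 : valuation F (c ^ 2) < 1 := by
    rw [map_pow, pow_two]; exact mul_lt_one_of_nonneg_of_lt_one_left zero_le hclt hc1
  have h2 : valuation F (c * e * u) < 1 := by
    rw [map_mul, map_mul]
    exact mul_lt_one_of_nonneg_of_lt_one_left zero_le (mul_lt_one_of_nonneg_of_lt_one_left zero_le hclt hev.le) hu1
  have h3 : valuation F (e ^ 2 * v) < 1 := by
    rw [map_mul, map_pow, pow_two]
    exact mul_lt_one_of_nonneg_of_lt_one_left zero_le (mul_lt_one_of_nonneg_of_lt_one_left zero_le hev hev.le) hv1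
  have h12 : valuation F (c ^ 2 + c * e * u) < 1 := lt_of_le_of_lt (Valuation.map_add _ _ _) (max_lt h1 h2)
  have h : valuation F (c ^ 2 + c * e * u - e ^ 2 * v) < 1 := lt_of_le_of_lt (Valuation.map_sub _ _ _) (max_lt h12 h3)
  rw [hN] at h
  exact lt_irrefl _ h

/-- **In the inert shape, `c + eτ` with `c` OR `e` a unit is a unit**: `|c² + ceu − e²v| = 1` (the norm is integral, and `< 1` would force `|c|, |e| < 1` by anisotropy).
[cite: LabesseLanglands1979, §2 p. 8] [cite: Neukirch1999, Ch. I §12] -/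
theorem valuation_inertNorm_eq_one_of_or {u v : F} (hu : u ∈ 𝒪[F]) (hv : v ∈ 𝒪[F])
    (hanis : ∀ c e : F, c ∈ 𝒪[F] → e ∈ 𝒪[F] → valuation F (c ^ 2 + c * e * u - e ^ 2 * v) < 1 → valuation F c < 1 ∧ valuation F e < 1)
    {c e : F} (hc : c ∈ 𝒪[F]) (he : e ∈ 𝒪[F]) (h : valuation F c = 1 ∨ valuation F e = 1) :
    valuation F (c ^ 2 + c * e * u - e ^ 2 * v) = 1 := by
  have hNO : c ^ 2 + c * e * u - e ^ 2 * v ∈ 𝒪[F] := sub_mem (add_mem (pow_mem hc 2) (mul_mem (mul_mem hc he) hu)) (mul_mem (pow_mem he 2) hv)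
  have hN1 : valuation F (c ^ 2 + c * e * u - e ^ 2 * v) ≤ 1 := (Valuation.mem_integer_iff _ _).1 hNO
  by_contra hne
  obtain ⟨hc', he'⟩ := hanis c e hc he (lt_of_le_of_ne hN1 hne)
  rcases h with h | h
  · rw [h] at hc'; exact lt_irrefl _ hc'
  · rw [h] at he'; exact lt_irrefl _ he'

/-- **THE NON-SPLIT ∕ INTEGRAL-BASIS BINDER `hE` OF (W′1) FOLLOWS FROM ANISOTROPY**: if `|p² + pqu − q²v| ≤ 1` then `p, q ∈ 𝒪` (scale the larger of `p, q` to a unit; the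
scaled norm has valuation `< 1`, contradicting `hanis`). [cite: LabesseLanglands1979, §2 p. 8] [cite: Serre1980Trees, Ch. II §1.3] -/
theorem integral_of_valuation_inertNorm_le_one {u v : F}
    (hanis : ∀ c e : F, c ∈ 𝒪[F] → e ∈ 𝒪[F] → valuation F (c ^ 2 + c * e * u - e ^ 2 * v) < 1 → valuation F c < 1 ∧ valuation F e < 1)
    (p q : F) (hN : valuation F (p ^ 2 + p * q * u - q ^ 2 * v) ≤ 1) : p ∈ 𝒪[F] ∧ q ∈ 𝒪[F] := by
  by_contra hnot
  rcases le_total (valuation F p) (valuation F q) with hpq | hqp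
  · -- `|p| ≤ |q|`, so `|q| > 1`; scale by `q⁻¹`
    have hq1 : 1 < valuation F q := by
      by_contra hle
      rw [not_lt] at hle
      exact hnot ⟨(Valuation.mem_integer_iff _ _).2 (hpq.trans hle), (Valuation.mem_integer_iff _ _).2 hle⟩
    have hq0 : q ≠ 0 := fun h => by rw [h, map_zero] at hq1; exact lt_irrefl _ (lt_of_le_of_lt zero_le hq1)
    have hvq0 : valuation F q ≠ 0 := (Valuation.ne_zero_iff _).2 hq0
    have hp' : p * q⁻¹ ∈ 𝒪[F] := by
      rw [Valuation.mem_integer_iff, map_mul, map_inv₀]; exact mul_inv_le_one_of_le₀ hpq zero_le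
    have hkey : (p * q⁻¹) ^ 2 + (p * q⁻¹) * 1 * u - 1 ^ 2 * v = (p ^ 2 + p * q * u - q ^ 2 * v) * (q ^ 2)⁻¹ := by
      field_simp
    have hlt : valuation F ((p * q⁻¹) ^ 2 + (p * q⁻¹) * 1 * u - 1 ^ 2 * v) < 1 := by
      rw [hkey, map_mul, map_inv₀, map_pow]
      have hq2 : 1 < valuation F q ^ 2 := by
        rw [pow_two]; exact one_lt_mul_of_lt_of_le hq1 hq1.le
      calc valuation F (p ^ 2 + p * q * u - q ^ 2 * v) * (valuation F q ^ 2)⁻¹ ≤ 1 * (valuation F q ^ 2)⁻¹ := mul_le_mul_of_nonneg_right hN zero_le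
        _ < 1 := by rw [one_mul]; exact inv_lt_one_of_one_lt₀ hq2
    have h := (hanis _ _ hp' (one_mem _) hlt).2
    rw [map_one] at h
    exact lt_irrefl _ h
  · -- `|q| ≤ |p|`, so `|p| > 1`; scale by `p⁻¹`
    have hp1 : 1 < valuation F p := by
      by_contra hle
      rw [not_lt] at hle
      exact hnot ⟨(Valuation.mem_integer_iff _ _).2 hle, (Valuation.mem_integer_iff _ _).2 (hqp.trans hle)⟩
    have hp0 : p ≠ 0 := fun h => by rw [h, map_zero] at hp1; exact lt_irrefl _ (lt_of_le_of_lt zero_le hp1)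
    have hvp0 : valuation F p ≠ 0 := (Valuation.ne_zero_iff _).2 hp0
    have hq' : q * p⁻¹ ∈ 𝒪[F] := by
      rw [Valuation.mem_integer_iff, map_mul, map_inv₀]; exact mul_inv_le_one_of_le₀ hqp zero_le
    have hkey : (1 : F) ^ 2 + 1 * (q * p⁻¹) * u - (q * p⁻¹) ^ 2 * v = (p ^ 2 + p * q * u - q ^ 2 * v) * (p ^ 2)⁻¹ := by
      field_simp
    have hlt : valuation F ((1 : F) ^ 2 + 1 * (q * p⁻¹) * u - (q * p⁻¹) ^ 2 * v) < 1 := by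
      rw [hkey, map_mul, map_inv₀, map_pow]
      have hp2 : 1 < valuation F p ^ 2 := by
        rw [pow_two]; exact one_lt_mul_of_lt_of_le hp1 hp1.le
      calc valuation F (p ^ 2 + p * q * u - q ^ 2 * v) * (valuation F p ^ 2)⁻¹ ≤ 1 * (valuation F p ^ 2)⁻¹ := mul_le_mul_of_nonneg_right hN zero_le
        _ < 1 := by rw [one_mul]; exact inv_lt_one_of_one_lt₀ hp2
    have h := (hanis _ _ (one_mem _) hq' hlt).1
    rw [map_one] at h
    exact lt_irrefl _ h

include hϖ in
/-- **NO ELEMENT OF THE INERT ORDER HAS NORM OF VALUATION `|ϖ|`** (the extension `E = F(τ)` is UNRAMIFIED: norms have EVEN valuation): for `c, e ∈ 𝒪`,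
`|c² + ceu − e²v| ≠ |ϖ|` — if the norm is a non-unit, anisotropy gives `c, e ∈ ϖ𝒪` and the norm lies in `ϖ²𝒪`. [cite: LabesseLanglands1979, §2 p. 8] [cite: Serre1980Trees, Ch. II §1.3] -/
theorem valuation_inertNorm_ne_valuation {u v : F} (hu : u ∈ 𝒪[F]) (hv : v ∈ 𝒪[F])
    (hanis : ∀ c e : F, c ∈ 𝒪[F] → e ∈ 𝒪[F] → valuation F (c ^ 2 + c * e * u - e ^ 2 * v) < 1 → valuation F c < 1 ∧ valuation F e < 1)
    {c e : F} (hc : c ∈ 𝒪[F]) (he : e ∈ 𝒪[F]) : valuation F (c ^ 2 + c * e * u - e ^ 2 * v) ≠ valuation F ϖ := by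
  intro h
  have hlt : valuation F (c ^ 2 + c * e * u - e ^ 2 * v) < 1 := by rw [h]; exact hϖ.valuation_lt_one
  obtain ⟨hc', he'⟩ := hanis c e hc he hlt
  obtain ⟨c₁, hc₁, rfl⟩ := hϖ.exists_eq_mul hc hc'
  obtain ⟨e₁, he₁, rfl⟩ := hϖ.exists_eq_mul he he'
  have hfac : (ϖ * c₁) ^ 2 + ϖ * c₁ * (ϖ * e₁) * u - (ϖ * e₁) ^ 2 * v = ϖ ^ 2 * (c₁ ^ 2 + c₁ * e₁ * u - e₁ ^ 2 * v) := by ring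
  have hNO : c₁ ^ 2 + c₁ * e₁ * u - e₁ ^ 2 * v ∈ 𝒪[F] := sub_mem (add_mem (pow_mem hc₁ 2) (mul_mem (mul_mem hc₁ he₁) hu)) (mul_mem (pow_mem he₁ 2) hv)
  rw [hfac, map_mul, map_pow] at h
  have hle : valuation F ϖ ^ 2 * valuation F (c₁ ^ 2 + c₁ * e₁ * u - e₁ ^ 2 * v) ≤ valuation F ϖ ^ 2 := mul_le_of_le_one_right zero_le ((Valuation.mem_integer_iff _ _).1 hNO)
  rw [h] at hle
  have hv0 : valuation F ϖ ≠ 0 := (Valuation.ne_zero_iff _).2 hϖ.ne_zero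
  have hlt : valuation F ϖ ^ 2 < valuation F ϖ ^ 1 := pow_lt_pow_right_of_lt_one₀ (zero_lt_iff.2 hv0) hϖ.valuation_lt_one (by norm_num)
  rw [pow_one] at hlt
  exact lt_irrefl _ (lt_of_le_of_lt hle hlt)

/-! ## §2 The coset criterion, shape-free -/

include hϖ in
/-- **THE COSET CRITERION (shape-free).**  Let `t, t′ ∈ TK` with `↑t = (c, ev; e, c+eu)`, `↑t′ = (c′, e′v; e′, c′+e′u)`.  Then
`t⁻¹ t′ ∈ r_m GL₂(𝒪) r_m⁻¹ ⟺ |c e′ − e c′| ≤ |ϖ|^m`: the τ-coordinate `e″` of `t⁻¹t′` satisfies `c e′ − e c′ = e″ · N(t)` with `N(t)` a unit, and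
`r_m⁻¹ (t⁻¹t′) r_m = (c″, e″vϖ^m; e″ϖ^{−m}, c″+e″u)` is integral iff `|e″| ≤ |ϖ|^m` (★ I `isIntegralMatrix_shellConj_iff`).  (★ V-INDEX's Eisenstein version divides by `c`;
this one does not, so it serves the inert shape where `c` need not be a unit.) [cite: LabesseLanglands1979, §2 (2.1) p. 8] -/
theorem inv_mul_mem_conj_glInt_iff_valuation_sub_le [IsDiscreteValuationRing 𝒪[F]] {u v : F} (hu : u ∈ 𝒪[F]) (hv : v ∈ 𝒪[F])
    {γτ : GL (Fin 2) F} (hγτ : (γτ : Matrix (Fin 2) (Fin 2) F) = !![0, v; 1, u])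
    {rm : GL (Fin 2) F} {m : ℕ} (hrm : (rm : Matrix (Fin 2) (Fin 2) F) = Matrix.diagonal ![1, ϖ ^ m])
    {t t' : GL (Fin 2) F} (ht : t ∈ Subgroup.centralizer ({γτ} : Set (GL (Fin 2) F)) ⊓ glInt 2 F)
    (ht' : t' ∈ Subgroup.centralizer ({γτ} : Set (GL (Fin 2) F)) ⊓ glInt 2 F) {c e c' e' : F}
    (htc : (t : Matrix (Fin 2) (Fin 2) F) = !![c, e * v; e, c + e * u]) (htc' : (t' : Matrix (Fin 2) (Fin 2) F) = !![c', e' * v; e', c' + e' * u]) :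
    t⁻¹ * t' ∈ (glInt 2 F).map (MulAut.conj rm).toMonoidHom ↔ valuation F (c * e' - e * c') ≤ valuation F ϖ ^ m := by
  have h0 := hϖ.ne_zero
  have hϖm : ϖ ^ m ≠ 0 := pow_ne_zero m h0
  have hdet : valuation F (c ^ 2 + c * e * u - e ^ 2 * v) = 1 := by
    rw [← QuadraticRegularRep.det_regRep, ← htc]; exact valuation_det_eq_one_of_mem_glInt ht.2
  -- `s := t⁻¹ t'` is in the torus and in `GL₂(𝒪)`
  have hs : t⁻¹ * t' ∈ Subgroup.centralizer ({γτ} : Set (GL (Fin 2) F)) ⊓ glInt 2 F := mul_mem (inv_mem ht) ht'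
  obtain ⟨c'', e'', hsc⟩ := exists_coe_eq_regRep_of_mem_centralizer_companion hγτ hs.1
  have hsi := isIntegralMatrix_of_mem_glInt hs.2
  have hc'' : c'' ∈ 𝒪[F] := by simpa [hsc] using hsi 0 0
  have he'' : e'' ∈ 𝒪[F] := by simpa [hsc] using hsi 1 0
  -- the τ-coordinate `e''`: from `t * (t⁻¹ t') = t'`
  have hprod : (t : Matrix (Fin 2) (Fin 2) F) * ((t⁻¹ * t' : GL (Fin 2) F) : Matrix (Fin 2) (Fin 2) F) = (t' : Matrix (Fin 2) (Fin 2) F) := by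
    rw [← Units.val_mul, mul_inv_cancel_left]
  rw [htc, hsc, htc', QuadraticRegularRep.regRep_mul] at hprod
  have h00 := congrArg (fun M : Matrix (Fin 2) (Fin 2) F => M 0 0) hprod
  have h10 := congrArg (fun M : Matrix (Fin 2) (Fin 2) F => M 1 0) hprod
  simp only [Matrix.of_apply, Matrix.cons_val', Matrix.cons_val_zero, Matrix.cons_val_one, Matrix.cons_val_fin_one, Matrix.empty_val'] at h00 h10
  -- `c e' − e c' = e'' · N(t)`
  have hkey : c * e' - e * c' = e'' * (c ^ 2 + c * e * u - e ^ 2 * v) := by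
    linear_combination e * h00 - c * h10
  have hval : valuation F (c * e' - e * c') = valuation F e'' := by
    rw [hkey, map_mul, hdet, mul_one]
  -- the conjugate `rm⁻¹ s rm`
  have hconj := coe_inv_mul_torus_mul_of_coe_eq_diagonal u v c'' e'' hsc hrm hϖm
  rw [Subgroup.mem_map_equiv, MulAut.conj_symm_apply, hval]
  have hdetc : valuation F ((rm⁻¹ * (t⁻¹ * t') * rm : GL (Fin 2) F) : Matrix (Fin 2) (Fin 2) F).det = 1 := by
    rw [Units.val_mul, Units.val_mul, Matrix.det_mul, Matrix.det_mul, mul_comm (((rm⁻¹ : GL (Fin 2) F) : Matrix (Fin 2) (Fin 2) F).det), mul_assoc, ← Matrix.det_mul,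
      ← Units.val_mul, inv_mul_cancel, Units.val_one, Matrix.det_one, mul_one]
    exact valuation_det_eq_one_of_mem_glInt hs.2
  rw [← map_pow, ← isIntegralMatrix_shellConj_iff hu hv hc'' he'' (hϖ.pow_mem m) hϖm, ← hconj]
  exact ⟨isIntegralMatrix_of_mem_glInt, fun h => mem_glInt_of_isIntegralMatrix h hdetc⟩

/-- **`TK(0) = TK`**: the shell-`0` representative `r_0 = diag(1, 1) = 1` conjugates `GL₂(𝒪)` to itself, so `TK(0).relIndex TK = 1` (shape-free). [cite: Serre1980Trees, Ch. II §1.3] -/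
theorem relIndex_torusInt_shellStab_zero {γτ : GL (Fin 2) F} {r0 : GL (Fin 2) F} (hr0 : (r0 : Matrix (Fin 2) (Fin 2) F) = Matrix.diagonal ![1, ϖ ^ 0]) :
    ((Subgroup.centralizer ({γτ} : Set (GL (Fin 2) F)) ⊓ glInt 2 F) ⊓ (glInt 2 F).map (MulAut.conj r0).toMonoidHom).relIndex
      (Subgroup.centralizer ({γτ} : Set (GL (Fin 2) F)) ⊓ glInt 2 F) = 1 := by
  have h1 : r0 = 1 := by
    apply Units.ext
    rw [hr0, pow_zero, Units.val_one]
    ext i j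
    fin_cases i <;> fin_cases j <;> simp
  subst h1
  have hmap : (glInt 2 F).map (MulAut.conj (1 : GL (Fin 2) F)).toMonoidHom = glInt 2 F := by
    rw [map_one]; exact Subgroup.map_id _
  rw [hmap, inf_assoc, inf_idem, Subgroup.relIndex_self]

/-! ## §3 The index `[TK : TK(m)] = (q + 1)·q^{m−1}` in the inert shape -/

include hϖ in
/-- **THE CONDUCTOR-`m` UNIT INDEX IN THE INERT SHAPE** (LL79 §2 p. 8 «`δ_m = (q+1)q^{m−1}` if `L` is unramified»; Serre, Trees II.1.1 — the sphere of radius `m` in the tree of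
`SL₂(F)`): with `TK := Subgroup.centralizer {γτ} ⊓ GL₂(𝒪)` (`= 𝒪_E^×`, `E = F(τ)` UNRAMIFIED) and `TK(m) := TK ⊓ r_m GL₂(𝒪) r_m⁻¹` (`= (𝒪 + ϖ^m𝒪τ)^×`), for `m ≥ 1`:
**`TK(m).relIndex TK = (q + 1)·q^{m−1}`**, `q = #𝓀_F`.  Proof: `t = (c, e) ↦ inl (c e⁻¹ mod 𝔪^m)` (`|e| = 1`), `↦ inr (e c⁻¹ ϖ⁻¹ mod 𝔪^{m−1})` (`|e| < 1`) is a bijection of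
the coset SPACE onto `(𝒪∕𝔪^m) ⊕ (𝒪∕𝔪^{m−1})` (the projective line over `𝒪∕𝔪^m`) by §2; onto by the units `(z, 1)`, `(1, ϖz)`.
[cite: LabesseLanglands1979, §2 p. 8] [cite: Serre1980Trees, Ch. II §1.1] [cite: Neukirch1999, Ch. I §12] -/
theorem relIndex_torusInt_shellStab_eq_of_inert [IsDiscreteValuationRing 𝒪[F]] [Finite (IsLocalRing.ResidueField 𝒪[F])] {u v : F} (hu : u ∈ 𝒪[F]) (hv : v ∈ 𝒪[F])
    (hanis : ∀ c e : F, c ∈ 𝒪[F] → e ∈ 𝒪[F] → valuation F (c ^ 2 + c * e * u - e ^ 2 * v) < 1 → valuation F c < 1 ∧ valuation F e < 1)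
    {γτ : GL (Fin 2) F} (hγτ : (γτ : Matrix (Fin 2) (Fin 2) F) = !![0, v; 1, u])
    {rm : GL (Fin 2) F} {m : ℕ} (hrm : (rm : Matrix (Fin 2) (Fin 2) F) = Matrix.diagonal ![1, ϖ ^ m]) (hm : 1 ≤ m) :
    ((Subgroup.centralizer ({γτ} : Set (GL (Fin 2) F)) ⊓ glInt 2 F) ⊓ (glInt 2 F).map (MulAut.conj rm).toMonoidHom).relIndex
      (Subgroup.centralizer ({γτ} : Set (GL (Fin 2) F)) ⊓ glInt 2 F) =
      (Nat.card (IsLocalRing.ResidueField 𝒪[F]) + 1) * Nat.card (IsLocalRing.ResidueField 𝒪[F]) ^ (m - 1) := by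
  classical
  have h0 := hϖ.ne_zero
  have hv0 : valuation F ϖ ≠ 0 := (Valuation.ne_zero_iff _).2 h0
  have hϖ1 := hϖ.valuation_lt_one
  set TK : Subgroup (GL (Fin 2) F) := Subgroup.centralizer ({γτ} : Set (GL (Fin 2) F)) ⊓ glInt 2 F with hTK
  set TKm : Subgroup (GL (Fin 2) F) := TK ⊓ (glInt 2 F).map (MulAut.conj rm).toMonoidHom with hTKm
  set H : Subgroup TK := TKm.subgroupOf TK with hH
  -- coordinates of an element of `TK`: `(c, e)` integral with unit norm; `|e| = 1` or (`|e| < 1` and `|c| = 1`)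
  have hcoord : ∀ t : TK, ∃ c e : F, ((t : GL (Fin 2) F) : Matrix (Fin 2) (Fin 2) F) = !![c, e * v; e, c + e * u] ∧ c ∈ 𝒪[F] ∧ e ∈ 𝒪[F] ∧
      valuation F (c ^ 2 + c * e * u - e ^ 2 * v) = 1 := by
    intro t
    obtain ⟨c, e, hc, he, htc, hdet⟩ := (mem_centralizer_inf_glInt_iff hu hv hγτ (t : GL (Fin 2) F)).1 t.2
    refine ⟨c, e, htc, hc, he, ?_⟩
    rw [← QuadraticRegularRep.det_regRep, ← htc]; exact hdet
  -- the entries `t₀₀ = c`, `t₁₀ = e`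
  have hent : ∀ (t : TK) (c e : F), ((t : GL (Fin 2) F) : Matrix (Fin 2) (Fin 2) F) = !![c, e * v; e, c + e * u] →
      ((t : GL (Fin 2) F) : Matrix (Fin 2) (Fin 2) F) 0 0 = c ∧ ((t : GL (Fin 2) F) : Matrix (Fin 2) (Fin 2) F) 1 0 = e := by
    intro t c e htc; rw [htc]; exact ⟨rfl, rfl⟩
  -- the two chart values
  have hinl : ∀ t : TK, valuation F (((t : GL (Fin 2) F) : Matrix (Fin 2) (Fin 2) F) 1 0) = 1 →
      ((t : GL (Fin 2) F) : Matrix (Fin 2) (Fin 2) F) 0 0 * (((t : GL (Fin 2) F) : Matrix (Fin 2) (Fin 2) F) 1 0)⁻¹ ∈ 𝒪[F] := by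
    intro t h1
    obtain ⟨c, e, htc, hc, he, -⟩ := hcoord t
    obtain ⟨h00, h10⟩ := hent t c e htc
    rw [h10] at h1
    rw [h00, h10, Valuation.mem_integer_iff, map_mul, map_inv₀, h1, inv_one, mul_one]
    exact (Valuation.mem_integer_iff _ _).1 hc
  have hinr : ∀ t : TK, ¬ valuation F (((t : GL (Fin 2) F) : Matrix (Fin 2) (Fin 2) F) 1 0) = 1 →
      ((t : GL (Fin 2) F) : Matrix (Fin 2) (Fin 2) F) 1 0 * (((t : GL (Fin 2) F) : Matrix (Fin 2) (Fin 2) F) 0 0)⁻¹ * ϖ⁻¹ ∈ 𝒪[F] := by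
    intro t h1
    obtain ⟨c, e, htc, hc, he, hN⟩ := hcoord t
    obtain ⟨h00, h10⟩ := hent t c e htc
    rw [h10] at h1
    rw [h00, h10]
    have hev : valuation F e < 1 := lt_of_le_of_ne ((Valuation.mem_integer_iff _ _).1 he) h1
    have hcv : valuation F c = 1 := valuation_eq_one_of_valuation_lt_one_of_inertNorm hu hv hc hev hN
    obtain ⟨e₁, he₁, rfl⟩ := hϖ.exists_eq_mul he hev
    have hc0 : c ≠ 0 := fun h => by rw [h, map_zero] at hcv; exact zero_ne_one hcv
    have : ϖ * e₁ * c⁻¹ * ϖ⁻¹ = e₁ * c⁻¹ := by field_simp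
    rw [this, Valuation.mem_integer_iff, map_mul, map_inv₀, hcv, inv_one, mul_one]
    exact (Valuation.mem_integer_iff _ _).1 he₁
  set ψ : TK → (𝒪[F] ⧸ IsLocalRing.maximalIdeal 𝒪[F] ^ m) ⊕ (𝒪[F] ⧸ IsLocalRing.maximalIdeal 𝒪[F] ^ (m - 1)) := fun t =>
    if h : valuation F (((t : GL (Fin 2) F) : Matrix (Fin 2) (Fin 2) F) 1 0) = 1 then
      Sum.inl (Ideal.Quotient.mk _ ⟨_, hinl t h⟩)
    else Sum.inr (Ideal.Quotient.mk _ ⟨_, hinr t h⟩) with hψ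
  -- KEY: `ψ t = ψ t' ↔ t⁻¹ t' ∈ H`
  have hkey : ∀ t t' : TK, ψ t = ψ t' ↔ t⁻¹ * t' ∈ H := by
    intro t t'
    obtain ⟨c, e, htc, hc, he, hN⟩ := hcoord t
    obtain ⟨c', e', htc', hc', he', hN'⟩ := hcoord t'
    obtain ⟨h00, h10⟩ := hent t c e htc
    obtain ⟨h00', h10'⟩ := hent t' c' e' htc'
    have hmemTK : ((t : GL (Fin 2) F))⁻¹ * (t' : GL (Fin 2) F) ∈ TK := mul_mem (inv_mem t.2) t'.2
    have hcrit : t⁻¹ * t' ∈ H ↔ valuation F (c * e' - e * c') ≤ valuation F ϖ ^ m := by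
      rw [hH, Subgroup.mem_subgroupOf, Subgroup.coe_mul, Subgroup.coe_inv, hTKm, Subgroup.mem_inf]
      simp only [hmemTK, true_and]
      exact inv_mul_mem_conj_glInt_iff_valuation_sub_le hϖ hu hv hγτ hrm t.2 t'.2 htc htc'
    rw [hcrit, hψ]
    simp only [h00, h10, h00', h10']
    have hc1 : valuation F c ≤ 1 := (Valuation.mem_integer_iff _ _).1 hc
    have hc1' : valuation F c' ≤ 1 := (Valuation.mem_integer_iff _ _).1 hc'
    have he1 : valuation F e ≤ 1 := (Valuation.mem_integer_iff _ _).1 he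
    have he1' : valuation F e' ≤ 1 := (Valuation.mem_integer_iff _ _).1 he'
    have hϖm1 : valuation F ϖ ^ m < 1 := pow_lt_one₀ zero_le hϖ1 (by omega)
    by_cases hE1 : valuation F e = 1 <;> by_cases hE1' : valuation F e' = 1
    · -- both `e, e'` units: compare `c/e` and `c'/e'` mod `𝔪^m`
      rw [dif_pos hE1, dif_pos hE1', Sum.inl.injEq, Ideal.Quotient.eq, mem_maximalIdeal_pow_iff_valuation_le_pow hϖ]
      have he0 : e ≠ 0 := fun h => by rw [h, map_zero] at hE1; exact zero_ne_one hE1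
      have he0' : e' ≠ 0 := fun h => by rw [h, map_zero] at hE1'; exact zero_ne_one hE1'
      have hq : c * e⁻¹ - c' * e'⁻¹ = (c * e' - e * c') * (e * e')⁻¹ := by field_simp
      show valuation F ((c * e⁻¹ - c' * e'⁻¹ : F)) ≤ _ ↔ _
      rw [hq, map_mul, map_inv₀, map_mul, hE1, hE1']
      simp only [mul_one, inv_one]
    · -- `e` unit, `e'` not: different charts; `|c e' − e c'| = 1`
      rw [dif_pos hE1, dif_neg hE1']
      simp only [reduceCtorEq, false_iff, not_le]
      have hev' : valuation F e' < 1 := lt_of_le_of_ne he1' hE1'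
      have hcv' : valuation F c' = 1 := valuation_eq_one_of_valuation_lt_one_of_inertNorm hu hv hc' hev' hN'
      have h1 : valuation F (e * c') = 1 := by rw [map_mul, hE1, hcv', mul_one]
      have h2 : valuation F (c * e') < 1 := by rw [map_mul]; exact mul_lt_one_of_nonneg_of_lt_one_right hc1 zero_le hev'
      have h3 : valuation F (c * e' - e * c') = 1 := by
        rw [← h1] at h2 ⊢; exact Valuation.map_sub_eq_of_lt_right _ h2
      rw [h3]; exact hϖm1
    · -- `e'` unit, `e` not: symmetric
      rw [dif_neg hE1, dif_pos hE1']
      simp only [reduceCtorEq, false_iff, not_le]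
      have hev : valuation F e < 1 := lt_of_le_of_ne he1 hE1
      have hcv : valuation F c = 1 := valuation_eq_one_of_valuation_lt_one_of_inertNorm hu hv hc hev hN
      have h1 : valuation F (c * e') = 1 := by rw [map_mul, hcv, hE1', mul_one]
      have h2 : valuation F (e * c') < 1 := by rw [map_mul]; exact mul_lt_one_of_nonneg_of_lt_one_left zero_le hev hc1'
      have h3 : valuation F (c * e' - e * c') = 1 := by
        rw [← h1] at h2 ⊢; exact Valuation.map_sub_eq_of_lt_left _ h2
      rw [h3]; exact hϖm1
    · -- both `e, e'` non-units (so `c, c'` units): compare `e/(cϖ)` and `e'/(c'ϖ)` mod `𝔪^{m-1}`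
      rw [dif_neg hE1, dif_neg hE1', Sum.inr.injEq, Ideal.Quotient.eq, mem_maximalIdeal_pow_iff_valuation_le_pow hϖ]
      have hev : valuation F e < 1 := lt_of_le_of_ne he1 hE1
      have hev' : valuation F e' < 1 := lt_of_le_of_ne he1' hE1'
      have hcv : valuation F c = 1 := valuation_eq_one_of_valuation_lt_one_of_inertNorm hu hv hc hev hN
      have hcv' : valuation F c' = 1 := valuation_eq_one_of_valuation_lt_one_of_inertNorm hu hv hc' hev' hN'
      have hc0 : c ≠ 0 := fun h => by rw [h, map_zero] at hcv; exact zero_ne_one hcv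
      have hc0' : c' ≠ 0 := fun h => by rw [h, map_zero] at hcv'; exact zero_ne_one hcv'
      have hq : e * c⁻¹ * ϖ⁻¹ - e' * c'⁻¹ * ϖ⁻¹ = -((c * e' - e * c') * (c * c')⁻¹ * ϖ⁻¹) := by field_simp; ring
      show valuation F ((e * c⁻¹ * ϖ⁻¹ - e' * c'⁻¹ * ϖ⁻¹ : F)) ≤ _ ↔ _
      rw [hq, Valuation.map_neg, map_mul, map_mul, map_inv₀, map_inv₀, map_mul, hcv, hcv', mul_one, inv_one, mul_one,
        mul_inv_le_iff₀ (zero_lt_iff.2 hv0), ← pow_succ, Nat.sub_add_cancel hm]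
  -- the induced map on the coset space is a bijection
  set Φ : (TK ⧸ H) → (𝒪[F] ⧸ IsLocalRing.maximalIdeal 𝒪[F] ^ m) ⊕ (𝒪[F] ⧸ IsLocalRing.maximalIdeal 𝒪[F] ^ (m - 1)) :=
    Quotient.lift (s := QuotientGroup.leftRel H) ψ (fun a b hab => (hkey a b).2 (QuotientGroup.leftRel_apply.1 hab)) with hΦ
  have hinj : Function.Injective Φ := by
    intro x y
    induction x using Quotient.inductionOn with | h a => ?_
    induction y using Quotient.inductionOn with | h b => ?_
    intro hab
    exact Quotient.sound (QuotientGroup.leftRel_apply.2 ((hkey a b).1 hab))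
  -- torus elements from integral coordinates with `c` or `e` a unit
  have hmk : ∀ c e : F, c ∈ 𝒪[F] → e ∈ 𝒪[F] → (valuation F c = 1 ∨ valuation F e = 1) →
      ∃ t : TK, ((t : GL (Fin 2) F) : Matrix (Fin 2) (Fin 2) F) = !![c, e * v; e, c + e * u] := by
    intro c e hc he h
    have hN := valuation_inertNorm_eq_one_of_or hu hv hanis hc he h
    have hdet0 : (!![c, e * v; e, c + e * u]).det ≠ 0 := by
      rw [QuadraticRegularRep.det_regRep]; intro h'; rw [h', map_zero] at hN; exact zero_ne_one hN
    set n : GL (Fin 2) F := Matrix.GeneralLinearGroup.mk'' _ (isUnit_iff_ne_zero.2 hdet0) with hn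
    have hncoe : (n : Matrix (Fin 2) (Fin 2) F) = !![c, e * v; e, c + e * u] := rfl
    have hnTK : n ∈ TK := (mem_centralizer_inf_glInt_iff hu hv hγτ n).2 ⟨c, e, hc, he, hncoe, by rw [hncoe, QuadraticRegularRep.det_regRep]; exact hN⟩
    exact ⟨⟨n, hnTK⟩, hncoe⟩
  have hsurj : Function.Surjective Φ := by
    rintro (y | y)
    · obtain ⟨z, rfl⟩ := Ideal.Quotient.mk_surjective y
      obtain ⟨t, htc⟩ := hmk z 1 z.2 (one_mem _) (Or.inr (map_one _))
      refine ⟨Quotient.mk _ t, ?_⟩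
      show ψ t = Sum.inl (Ideal.Quotient.mk _ z)
      obtain ⟨h00, h10⟩ := hent t z 1 htc
      have h1 : valuation F (((t : GL (Fin 2) F) : Matrix (Fin 2) (Fin 2) F) 1 0) = 1 := by rw [h10, map_one]
      rw [hψ]; dsimp only; rw [dif_pos h1]
      congr 2
      exact Subtype.ext (by simp only [h00, h10, inv_one, mul_one])
    · obtain ⟨z, rfl⟩ := Ideal.Quotient.mk_surjective y
      obtain ⟨t, htc⟩ := hmk 1 (ϖ * z) (one_mem _) (mul_mem hϖ.mem z.2) (Or.inl (map_one _))
      refine ⟨Quotient.mk _ t, ?_⟩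
      show ψ t = Sum.inr (Ideal.Quotient.mk _ z)
      obtain ⟨h00, h10⟩ := hent t 1 (ϖ * z) htc
      have h1 : ¬ valuation F (((t : GL (Fin 2) F) : Matrix (Fin 2) (Fin 2) F) 1 0) = 1 := by
        rw [h10, map_mul]
        exact ne_of_lt (mul_lt_one_of_nonneg_of_lt_one_left zero_le hϖ1 ((Valuation.mem_integer_iff _ _).1 z.2))
      rw [hψ]; dsimp only; rw [dif_neg h1]
      congr 2
      exact Subtype.ext (by simp only [h00, h10, inv_one, mul_one]; field_simp)
  -- count
  have hq : ∀ k : ℕ, Nat.card (𝒪[F] ⧸ IsLocalRing.maximalIdeal 𝒪[F] ^ k) = Nat.card (IsLocalRing.ResidueField 𝒪[F]) ^ k := by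
    intro k
    have h := cardQuot_pow_of_prime (S := 𝒪[F]) (P := IsLocalRing.maximalIdeal 𝒪[F]) (IsDiscreteValuationRing.not_a_field _) (i := k)
    rw [Submodule.cardQuot_apply, Submodule.cardQuot_apply] at h
    exact h
  have hqpos : 0 < Nat.card (IsLocalRing.ResidueField 𝒪[F]) := Nat.card_pos
  haveI : Finite (𝒪[F] ⧸ IsLocalRing.maximalIdeal 𝒪[F] ^ m) := Nat.finite_of_card_ne_zero (by rw [hq]; positivity)
  haveI : Finite (𝒪[F] ⧸ IsLocalRing.maximalIdeal 𝒪[F] ^ (m - 1)) := Nat.finite_of_card_ne_zero (by rw [hq]; positivity)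
  have hcard : Nat.card (TK ⧸ H) = Nat.card ((𝒪[F] ⧸ IsLocalRing.maximalIdeal 𝒪[F] ^ m) ⊕ (𝒪[F] ⧸ IsLocalRing.maximalIdeal 𝒪[F] ^ (m - 1))) :=
    Nat.card_eq_of_bijective Φ ⟨hinj, hsurj⟩
  show (TKm.subgroupOf TK).index = _
  rw [← hH]
  show Nat.card (TK ⧸ H) = _
  rw [hcard, Nat.card_sum, hq, hq]
  obtain ⟨k, rfl⟩ : ∃ k, m = k + 1 := ⟨m - 1, by omega⟩
  rw [Nat.add_sub_cancel, pow_succ]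
  ring

end Literature.NumberTheory.Automorphic.HermitianLatticeTree

end
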